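import Literature.Probability.LatticeModels.SixVertexGFF
import Literature.Probability.Moments.GaussianMomentMethod

/-!
# Theorem 52, mode (2): convergence in law of `⟨h^{(δ)}, ρ⟩` from the convergence of its moments
# (DKLM 2026, Part II §3)

H. Duminil-Copin, K. K. Kozlowski, P. Lammers, I. Manolescu, *Gaussian free field convergence of
the six-vertex model with `-1 ≤ Δ ≤ -1/2`*, arXiv:2603.06268 (2026) [DKLM2026SixVertexGFF]
(`paper:arxiv-2603.06268`, chunk p0034):

> **Theorem 52 (criterion), proof, convergence in law.** […] it suffices to consider a single
> generalised test function `φ` […] and prove that `⟨h^{(δ_n)}, φ⟩ → 𝒩(0, σ² ∫∫ G dφ dφ)` in law.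
> Since a normal distribution is determined by its moments, it suffices to prove that all moments
> of the random variable `⟨h^{(δ_n)}, φ⟩` converge to the desired limits [Billingsley 1995], which
> is precisely what we will do.

We formalize exactly this reduction for the pairings `testPairing ω δ ρ` of the statement file: if,
as `δ → 0⁺`, every moment `𝔼_P[⟨h^{(δ)}, ρ⟩^k]` converges to the `k`-th moment of `𝒩(0, v)`, then
`𝔼_P[g(⟨h^{(δ)}, ρ⟩)] → ∫ g d𝒩(0, v)` for every bounded continuous `g` — the mode-(2) clause of
Theorem 2.8 for this `ρ` (with `v = σ² ℰ(ρ)`) — by the method of moments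
(`Literature.Probability.Moments.tendsto_integral_of_tendsto_integral_pow`, Mathlib's Lévy
continuity theorem) along sequences `δ_n → 0⁺`. The convergence of the moments themselves
(`= ∫ Φ_k^{(δ)} dρ̃^k → σ^k ∫ Ψ_k^GFF dρ̃^k`, dominated convergence via the regularity estimate) is
the hypothesis `hmom`.
-/

noncomputable section

open MeasureTheory ProbabilityTheory Filter Topology BoundedContinuousFunction

namespace Literature.Probability.LatticeModels.SixVertex

/-- **Theorem 52, convergence in law from the moments (DKLM Part II §3).** For a probability
measure `P` on arrow configurations, a test density `ρ` and `v ≥ 0`: if `ω ↦ ⟨h^{(δ)}(ω), ρ⟩` is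
measurable with all moments and `𝔼_P[⟨h^{(δ)}, ρ⟩^k] → ∫ x^k d𝒩(0,v)` as `δ → 0⁺` for every `k`,
then `𝔼_P[g(⟨h^{(δ)}, ρ⟩)] → ∫ g d𝒩(0,v)` for every bounded continuous `g : ℝ → ℝ`.
[cite: DKLM2026SixVertexGFF, Part II §3, proof of Theorem 52 (convergence in law)] -/
theorem tendsto_integral_testPairing_of_tendsto_moments {P : Measure (Config (ℤ × ℤ))} [IsProbabilityMeasure P]
    {ρ : ℂ → ℝ} {v : NNReal} (hmeas : ∀ δ : ℝ, AEMeasurable (fun ω => testPairing ω δ ρ) P)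
    (hint : ∀ (δ : ℝ) (k : ℕ), Integrable (fun ω => testPairing ω δ ρ ^ k) P)
    (hmom : ∀ k : ℕ, Tendsto (fun δ => ∫ ω, testPairing ω δ ρ ^ k ∂P) (𝓝[>] (0 : ℝ))
      (𝓝 (∫ x, x ^ k ∂gaussianReal 0 v)))
    (g : ℝ →ᵇ ℝ) :
    Tendsto (fun δ => ∫ ω, g (testPairing ω δ ρ) ∂P) (𝓝[>] (0 : ℝ)) (𝓝 (∫ x, g x ∂gaussianReal 0 v)) := by
  rw [tendsto_iff_seq_tendsto]
  intro δs hδs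
  -- the laws of the pairings along the sequence
  set μ : ℕ → ProbabilityMeasure ℝ := fun n =>
    ⟨P.map fun ω => testPairing ω (δs n) ρ, Measure.isProbabilityMeasure_map (hmeas _)⟩ with hμ
  have hμn : ∀ n, ((μ n : ProbabilityMeasure ℝ) : Measure ℝ) = P.map fun ω => testPairing ω (δs n) ρ := fun n => rfl
  have hintegral : ∀ (n : ℕ) (f : ℝ → ℝ), Continuous f →
      ∫ x, f x ∂(μ n : Measure ℝ) = ∫ ω, f (testPairing ω (δs n) ρ) ∂P := by
    intro n f hf
    rw [hμn, integral_map (hmeas _) hf.aestronglyMeasurable]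
  have hμint : ∀ n k, Integrable (fun x : ℝ => x ^ k) (μ n : Measure ℝ) := by
    intro n k
    rw [hμn, integrable_map_measure (by fun_prop) (hmeas _)]
    exact hint _ k
  have hμmom : ∀ k : ℕ, Tendsto (fun n => ∫ x, x ^ k ∂(μ n : Measure ℝ)) atTop (𝓝 (∫ x, x ^ k ∂gaussianReal 0 v)) := by
    intro k
    have h := (hmom k).comp hδs
    refine h.congr fun n => ?_
    simp only [Function.comp_apply]
    exact (hintegral n (fun x => x ^ k) (by fun_prop)).symm
  set ν : ProbabilityMeasure ℝ := ⟨gaussianReal 0 v, inferInstance⟩ with hν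
  have h := Literature.Probability.Moments.tendsto_integral_of_tendsto_integral_pow (ν := ν) hμint
    (fun s => integrable_exp_mul_gaussianReal s) hμmom g
  refine h.congr fun n => ?_
  simp only [Function.comp_apply]
  exact hintegral n g g.continuous

end Literature.Probability.LatticeModels.SixVertex

end
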